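import Summits.BirchSwinnertonDyer.BirchSwinnertonDyer.Theorems.PrintCFramBottomClassIndexLawFiveLeEisensteinEndStateV7
import Summits.BirchSwinnertonDyer.Rank1Residual.X12.CMIsogenyInvariance
import Summits.BirchSwinnertonDyer.Rank1Residual.X2.RankOneHeegner
import Literature.NumberTheory.EllipticCurves.IsogenyQuadraticTwistProofs
import Literature.NumberTheory.EllipticCurves.IsogenyConductorModularityProofs
import Literature.NumberTheory.EllipticCurves.ComplexMultiplicationLFunctionIsogenyHoldsProofs
import Literature.NumberTheory.EllipticCurves.ComplexMultiplicationBSDTripleProofs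
import Summits.BirchSwinnertonDyer.BirchSwinnertonDyer.Theorems.SemiOrdinaryEisensteinDescentWildKolyvaginUpperAtThreeOfJointUpper
import Summits.BirchSwinnertonDyer.Rank1Residual.X12.O11.RouteUTamagawaCM
import HarnessLib

/-!
# Route `PrintCFram`, crux C2 `BottomClassIndexLawFiveLe` (stmt-BirchSwinnertonDyer-20372), line `eisenstein-resource-bdp-line`:
# TRANSPORT of the Kolyvagin inequality along ℚ-isogenies — «one model, one datum» suffices

Cell `bsd-print-cfram`, LEAD seat `bsd-line-cfram-p1` (generation g6), `--supports stmt-BirchSwinnertonDyer-20372` (helper); third file after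
`…KrizLiLocusKolyvagin` (p635037) and `…EisensteinEndStateV7` (p635725). HONEST FRAMING. The crux C2 is CLASS-WIDE and stays OPEN; no definition, no
named fact, no `sorry`; every theorem is CONDITIONAL on the displayed published facts and on the research statements of the skeleton. BSD is not proved
by any of this; no summit statement is proved by this seat.

ANATOMY OF THE KOLYVAGIN STUB. v7's `stub_kolyvaginUpper_borelCM` asks for the UPPER index half `Upper.IndexUpperBoundLeAt W p K P (v_p c(Dt))` at
EVERY member `W`, EVERY admissible Heegner field and EVERY parametrisation datum `Dt`. Two facts make most of that quantification redundant:
(a) `BSD_p` is a ℚ-ISOGENY INVARIANT in analytic rank `≤ 1` (Cassels; `X2.bsdp_of_isIsogenous_of_bsdp`), and every binder of the class and of a Kriz–Li datum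
is an isogeny invariant too (CM, `CMRamified`, `r_an`, `N_W`, the trace form `a_ℓ`, the additive primes — `X12.CMIsogenyInvariance`, Faltings/Knapp
`LFunction_eq_of_isIsogenous_holds`, `conductorNorm_eq_of_isIsogenous_of_modularity`); (b) `BSD_p(W)` together with Burungale–Flach for the partner gives
the UPPER half back at EVERY admissible datum of `W` (`indexUpperBoundLeAt_of_bsdp_of_bsdp`; the gate's dedup rule requires importing its module `…WildKolyvaginUpperAtThreeOfJointUpper`, which sits in the SOED theses-cone — lint warning accepted). Hence:
* §5 `bsdp_cmRamified_of_krizLiDatum_of_isIsogenous_indexUpper` — at a Kriz–Li datum of `W` over `K''`, `BSD_p(W)` follows from the UPPER half at ONE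
  Heegner datum `(Dt₀, H₀, ι₀, P₀)` over `K''` of ONE globally minimal `W₀` isogenous to `W` (print supplies the LOWER half for `W₀`: §1 of
  `…KrizLiLocusKolyvagin` after transporting the Kriz–Li binders to `W₀`); `indexUpper_cmRamified_all_of_one` — and then the UPPER half holds at every
  admissible datum of every member of the isogeny class.
* §5 `bsdp_cmRamified_of_flatIncl_of_isIsogenous_indexUpper` — off the locus likewise: β1 for `W₀` (LOWER at that datum, pointwise
  `indexLowerBoundLeAt_of_flatInclLe_of_control`) + UPPER at ONE datum of `W₀` ⟹ `BSD_p(W₀)` ⟹ `BSD_p(W)`; `exists_krizLiDatum_of_isIsogenous` transports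
  «has a Kriz–Li datum» along isogenies (so «no Kriz–Li datum» is a property of the isogeny class and β1-off-the-locus applies to `W₀`).
* (sequel file `…EisensteinEndStateV8`) §6 `bottomClassIndexLawFiveLe_of_prints7_of_krizLi_of_kolyvaginUpperOneModel_of_flatInclOffKrizLi` — the v8 END STATE: the crux BY NAME from the
  seven citations, Kriz–Li Thm. 1.20, β1 off the Kriz–Li locus, and the WEAKENED Kolyvagin stub «for every member `W` and every admissible Heegner
  field `K''` (`d` odd `< −4`, Heegner for `N_W`, `L(W^{(d)},1) ≠ 0`) SOME isogenous globally minimal `W₀` and SOME Heegner datum of `W₀` over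
  `K''` satisfy the Tamagawa-free UPPER half `ord_p #Ш(W₀/K'') + 2·v_p(c(Dt₀)) ≤ 2·ord_p [W₀(K''):ℤP₀]`» — the freedom Kolyvagin's argument at the Borel CM-ramified prime wants (the isogeny switch `W ↔ W/W[𝔭]` to the
  model whose `W[𝔭]`-eigenline is visible; the parametrisation with `p ∤ c`).

References: [Cassels1965ArithmeticVIII]; [MilneADT2006] Thm. I.7.3; [GrossZagier1986] I.(6.3), Thm. I.7.3; [JetchevSkinnerWan2017] §7.4.1;
[KrizLi2019] Thm. 1.20; [GrigorovJorzaPatrikisSteinTarnita2009] Thm. 3.7, Props. 5.2–5.4; [FriedbergHoffstein1995] Thm. B; [BurungaleFlach2024] Cor. 2;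
[SilvermanAEC2009] III.6; [CremonaAlgorithms1997] §3.9.
-/


set_option autoImplicit false
-- the summit namespace `Summit.BirchSwinnertonDyer.BirchSwinnertonDyer` repeats the problem name by design (D-0017)
set_option linter.dupNamespace false

noncomputable section

open scoped Classical

namespace Summit.BirchSwinnertonDyer.BirchSwinnertonDyer.Theorems.PrintCFram.KrizLiKolyvagin

open WeierstrassCurve NumberField IsDedekindDomain Field PowerSeries
  Literature.NumberTheory.EllipticCurves Literature.NumberTheory.EllipticCurves.GreenbergSelmer
  Literature.NumberTheory.EllipticCurves.GreenbergVatsal2000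
  Literature.NumberTheory.EllipticCurves.ModularForms
  Literature.NumberTheory.EllipticCurves.KrizLi2019
  Literature.NumberTheory.GaloisCohomology
  Literature.NumberTheory.EllipticCurves.Rank1Residual
  Literature.NumberTheory.EllipticCurves.Rank1Residual.Typed
  Literature.NumberTheory.GaloisRepresentations
  Summit.BirchSwinnertonDyer.Rank1Residual
  Summit.BirchSwinnertonDyer.Rank1Residual.Additive
  Summit.BirchSwinnertonDyer.Rank1Residual.X11b Summit.BirchSwinnertonDyer.Rank1Residual.X11b.AcSelmer
  Summit.BirchSwinnertonDyer.Rank1Residual.X11b.Halves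
  Summit.BirchSwinnertonDyer.Rank1Residual.X12
  Summit.BirchSwinnertonDyer.Rank1Residual.X2.ResidualDevissageModules
  Summit.BirchSwinnertonDyer.BirchSwinnertonDyer.Theses.UniversalToricDescent
  Summit.BirchSwinnertonDyer.BirchSwinnertonDyer.Theorems
  Summit.BirchSwinnertonDyer.BirchSwinnertonDyer.Theorems.SchneiderFree
  Summit.BirchSwinnertonDyer.BirchSwinnertonDyer.Theorems.UniversalToricDescentWaldspurgerFlat
  Summit.BirchSwinnertonDyer.BirchSwinnertonDyer.Theorems.UniversalToricDescentStrictPlace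
  Summit.BirchSwinnertonDyer.BirchSwinnertonDyer.Theorems.RamifiedSevenEllipticUnits
  Summit.BirchSwinnertonDyer.BirchSwinnertonDyer.Theorems.PrintCFram
  Summit.BirchSwinnertonDyer.BirchSwinnertonDyer.Theorems.PrintCFram.EisensteinResourceBdpLine

/-! ## §5 Transport along ℚ-isogenies: one model, one datum -/

section Transport

variable {p : ℕ} [Fact p.Prime]

/-- **The Tamagawa term is void on the class**: for a CM curve `W/ℚ` and `p ≥ 5`, `p ∤ ∏ c_ℓ(W)` (no multiplicative place; Kodaira–Néron `c_ℓ ≤ 4`;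
bsd-cm's `RouteU.not_dvd_tamagawaProduct_of_hasCM`), so the UPPER index half `ord_p #Ш(W/K) + 2·ord_p ∏ c_ℓ + 2s ≤ 2·ord_p [W(K):ℤP]` IS the
Tamagawa-free inequality `ord_p #Ш(W/K) + 2s ≤ 2·ord_p [W(K):ℤP]` — the shape in which the Kolyvagin stub is stated from v8 on.
[cite: SilvermanATAEC1994, Thm. II.6.4 and Cor. IV.9.2(d)] [cite: JetchevSkinnerWan2017, §7.4.1 (arXiv:1512.06894 p. 30)] -/
theorem indexUpperBoundLeAt_of_sha_le_index_of_hasCM {W : WeierstrassCurve ℚ} [W.IsElliptic] (hCM : W.HasCM) (h5 : 5 ≤ p)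
    {K : Type} [Field K] [NumberField K] {P : (W.baseChange K).toAffine.Point} {s : ℕ}
    (h : padicValNat p (W.baseChange K).shaOrder + 2 * s ≤ 2 * padicValNat p (AddSubgroup.zmultiples P).index) :
    Upper.IndexUpperBoundLeAt W p K P s := by
  have hp : p.Prime := Fact.out
  have htam : padicValNat p W.tamagawaProduct = 0 :=
    padicValNat.eq_zero_of_not_dvd (X12.O11.RouteU.not_dvd_tamagawaProduct_of_hasCM W hCM p hp h5)
  unfold Upper.IndexUpperBoundLeAt
  rw [htam]
  omega

omit [Fact p.Prime] in
/-- Conversely the UPPER index half gives the Tamagawa-free inequality (trivially). [folklore] -/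
theorem sha_le_index_of_indexUpperBoundLeAt {W : WeierstrassCurve ℚ} {K : Type} [Field K] [NumberField K]
    {P : (W.baseChange K).toAffine.Point} {s : ℕ} (h : Upper.IndexUpperBoundLeAt W p K P s) :
    padicValNat p (W.baseChange K).shaOrder + 2 * s ≤ 2 * padicValNat p (AddSubgroup.zmultiples P).index := by
  unfold Upper.IndexUpperBoundLeAt at h
  omega

/-- **The trace form, the additive-prime condition and the twist non-vanishing move along a ℚ-isogeny.** For `W ∼ W₀` over `ℚ`:
`a_ℓ(W₀) = a_ℓ(W)` (Faltings/Knapp, `LFunction_eq_of_isIsogenous_holds`), `N_{W₀} = N_W` (modularity supply), the additive primes agree (a prime is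
bad iff it divides the conductor; CM curves have no multiplicative prime), `L(W₀^{(d)},1) = L(W^{(d)},1)` (twisting commutes with isogenies). So
Kriz–Li's curve-level binders at `(W, p)` are binders at `(W₀, p)`. [cite: SilvermanAEC2009, Thm. III.6.1] [cite: CremonaAlgorithms1997, §3.9 (p. 87)] -/
theorem krizLiBinders_of_isIsogenous (hmodP : nonempty_modularParametrizationData)
    {W W₀ : WeierstrassCurve ℚ} [W.IsElliptic] [W₀.IsElliptic] (hiso : IsIsogenous W W₀) (hCM : W.HasCM)
    {f : ℕ} (ψ : DirichletCharacter ℚ_[p] f) (ω : DirichletCharacter ℚ_[p] p)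
    (hss : ∀ ℓ : ℕ, ℓ.Prime → ¬ (ℓ ∣ p * W.conductorNorm ℤ) →
      ‖((W.LFunction ℓ : ℤ) : ℚ_[p]) - (ψ (ℓ : ZMod f) + ψ⁻¹ (ℓ : ZMod f) * ω (ℓ : ZMod p))‖ < 1)
    (h3 : ∀ ℓ : ℕ, (hℓ : ℓ.Prime) → ℓ ≠ p →
      (haveI := Fact.mk hℓ; ¬ W.HasGoodReductionAtPrime ℓ ∧ ¬ W.HasMultiplicativeReductionAtPrime ℓ) →
      ψ (ℓ : ZMod f) ≠ 1 ∧ KrizLi2019.primVal (KrizLi2019.invMulOmega ψ ω) ℓ ≠ 1) :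
    W₀.conductorNorm ℤ = W.conductorNorm ℤ ∧
    (∀ ℓ : ℕ, ℓ.Prime → ¬ (ℓ ∣ p * W₀.conductorNorm ℤ) →
      ‖((W₀.LFunction ℓ : ℤ) : ℚ_[p]) - (ψ (ℓ : ZMod f) + ψ⁻¹ (ℓ : ZMod f) * ω (ℓ : ZMod p))‖ < 1) ∧
    (∀ ℓ : ℕ, (hℓ : ℓ.Prime) → ℓ ≠ p →
      (haveI := Fact.mk hℓ; ¬ W₀.HasGoodReductionAtPrime ℓ ∧ ¬ W₀.HasMultiplicativeReductionAtPrime ℓ) →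
      ψ (ℓ : ZMod f) ≠ 1 ∧ KrizLi2019.primVal (KrizLi2019.invMulOmega ψ ω) ℓ ≠ 1) := by
  have hN : W₀.conductorNorm ℤ = W.conductorNorm ℤ := (conductorNorm_eq_of_isIsogenous_of_modularity hmodP W W₀ hiso).symm
  have hLF : W₀.LFunction = W.LFunction := (LFunction_eq_of_isIsogenous_holds W W₀ hiso).symm
  refine ⟨hN, fun ℓ hℓ hdvd ↦ ?_, fun ℓ hℓ hℓp hadd ↦ ?_⟩
  · rw [hLF]; rw [hN] at hdvd; exact hss ℓ hℓ hdvd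
  · haveI := Fact.mk hℓ
    refine h3 ℓ hℓ hℓp ⟨fun hg ↦ hadd.1 ?_, fun hm ↦ W.not_hasMultiplicativeReductionAtPrime_of_hasCM hCM ℓ hm⟩
    -- `ℓ` good for `W` ⟹ `ℓ ∤ N_W = N_{W₀}` ⟹ `ℓ` good for `W₀`
    by_contra hb
    have h1 : (ℓ : ℤ) ∣ W₀.conductorNorm ℤ := by
      exact_mod_cast (W₀.dvd_conductorNorm_iff_not_hasGoodReductionAtPrime ℓ).mpr hb
    have h2 : ¬ ((ℓ : ℕ) ∣ W.conductorNorm ℤ) := fun h ↦ ((W.dvd_conductorNorm_iff_not_hasGoodReductionAtPrime ℓ).mp h) hg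
    rw [hN] at h1
    exact h2 (by exact_mod_cast h1)

/-- **«Has a Kriz–Li datum» is a property of the ℚ-isogeny class** (within the CM-ramified class): if `W ∼ W₀` (both globally minimal, CM) and `W`
carries a Kriz–Li Heegner datum (Heegner field `K''` with `d` odd `< −4`, `L(W^{(d)},1) ≠ 0`, binders `ψ, ω, (1), (3)`, `ε_K`, (4)), then so does `W₀`,
over the same `K''` (the Heegner point of `W₀` from `exists_isHeegnerPoint`, a conjunct of `ToricPublishedInputs`).
[cite: KrizLi2019, Thm. 1.20 (pp. 7–8)] [cite: GrossZagier1986, I.(6.3)] -/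
theorem exists_krizLiDatum_of_isIsogenous (hF : ToricPublishedInputs)
    {W W₀ : WeierstrassCurve ℚ} [W.IsElliptic] [W.IsGloballyMinimal] [W₀.IsElliptic] [W₀.IsGloballyMinimal]
    (hiso : IsIsogenous W W₀) (hCM : W.HasCM)
    (h : ∃ (N : ℕ) (_ : NeZero N) (K : Type) (_ : Field K) (_ : NumberField K) (Dt : ModularParametrizationData W N)
          (H : HeegnerDatum N (NumberField.discr K)) (ι : K →+* ℂ) (P : (W.baseChange K).toAffine.Point)
          (f : ℕ) (_ : NeZero f) (ψ : DirichletCharacter ℚ_[p] f) (ω : DirichletCharacter ℚ_[p] p)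
          (εK : DirichletCharacter ℚ_[p] (NumberField.discr K).natAbs),
          W.conductorNorm ℤ = N ∧ IsImaginaryQuadratic K ∧ SatisfiesHeegnerHypothesis N K ∧ Odd (NumberField.discr K) ∧
          NumberField.discr K < -4 ∧ (W.quadraticTwist (NumberField.discr K : ℚ)).entireLFunction 1 ≠ 0 ∧
          WeierstrassCurve.Affine.Point.map ι.toRatAlgHom P = heegnerPointComplex Dt H ∧
          ψ.IsPrimitive ∧ KrizLi2019.IsTeichmullerCharacter ω ∧
          (∀ ℓ : ℕ, ℓ.Prime → ¬ (ℓ ∣ p * W.conductorNorm ℤ) →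
            ‖((W.LFunction ℓ : ℤ) : ℚ_[p]) - (ψ (ℓ : ZMod f) + ψ⁻¹ (ℓ : ZMod f) * ω (ℓ : ZMod p))‖ < 1) ∧
          ψ (p : ZMod f) ≠ 1 ∧ KrizLi2019.primVal (KrizLi2019.invMulOmega ψ ω) p ≠ 1 ∧
          (∀ ℓ : ℕ, (hℓ : ℓ.Prime) → ℓ ≠ p →
            (haveI := Fact.mk hℓ; ¬ W.HasGoodReductionAtPrime ℓ ∧ ¬ W.HasMultiplicativeReductionAtPrime ℓ) →
            ψ (ℓ : ZMod f) ≠ 1 ∧ KrizLi2019.primVal (KrizLi2019.invMulOmega ψ ω) ℓ ≠ 1) ∧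
          KrizLi2019.IsKroneckerCharacterOf K εK ∧
          ¬ (‖KrizLi2019.bernoulliOnePrim (KrizLi2019.bernoulliCharOne ψ εK) *
              KrizLi2019.bernoulliOnePrim (KrizLi2019.bernoulliCharTwo ψ εK ω)‖ ≤ (p : ℝ)⁻¹)) :
    ∃ (N : ℕ) (_ : NeZero N) (K : Type) (_ : Field K) (_ : NumberField K) (Dt : ModularParametrizationData W₀ N)
          (H : HeegnerDatum N (NumberField.discr K)) (ι : K →+* ℂ) (P : (W₀.baseChange K).toAffine.Point)
          (f : ℕ) (_ : NeZero f) (ψ : DirichletCharacter ℚ_[p] f) (ω : DirichletCharacter ℚ_[p] p)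
          (εK : DirichletCharacter ℚ_[p] (NumberField.discr K).natAbs),
          W₀.conductorNorm ℤ = N ∧ IsImaginaryQuadratic K ∧ SatisfiesHeegnerHypothesis N K ∧ Odd (NumberField.discr K) ∧
          NumberField.discr K < -4 ∧ (W₀.quadraticTwist (NumberField.discr K : ℚ)).entireLFunction 1 ≠ 0 ∧
          WeierstrassCurve.Affine.Point.map ι.toRatAlgHom P = heegnerPointComplex Dt H ∧
          ψ.IsPrimitive ∧ KrizLi2019.IsTeichmullerCharacter ω ∧
          (∀ ℓ : ℕ, ℓ.Prime → ¬ (ℓ ∣ p * W₀.conductorNorm ℤ) →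
            ‖((W₀.LFunction ℓ : ℤ) : ℚ_[p]) - (ψ (ℓ : ZMod f) + ψ⁻¹ (ℓ : ZMod f) * ω (ℓ : ZMod p))‖ < 1) ∧
          ψ (p : ZMod f) ≠ 1 ∧ KrizLi2019.primVal (KrizLi2019.invMulOmega ψ ω) p ≠ 1 ∧
          (∀ ℓ : ℕ, (hℓ : ℓ.Prime) → ℓ ≠ p →
            (haveI := Fact.mk hℓ; ¬ W₀.HasGoodReductionAtPrime ℓ ∧ ¬ W₀.HasMultiplicativeReductionAtPrime ℓ) →
            ψ (ℓ : ZMod f) ≠ 1 ∧ KrizLi2019.primVal (KrizLi2019.invMulOmega ψ ω) ℓ ≠ 1) ∧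
          KrizLi2019.IsKroneckerCharacterOf K εK ∧
          ¬ (‖KrizLi2019.bernoulliOnePrim (KrizLi2019.bernoulliCharOne ψ εK) *
              KrizLi2019.bernoulliOnePrim (KrizLi2019.bernoulliCharTwo ψ εK ω)‖ ≤ (p : ℝ)⁻¹) := by
  obtain ⟨-, -, -, -, hmodP, -, -, -, -, hHP⟩ := hF
  obtain ⟨N, _, K, _, _, Dt, H, ι, P, f, _, ψ, ω, εK, hN, hK, hHN, hodd, hd4, hLt, hP, hψ, hω, hss, h1, h1', h3, hεK, h4⟩ := h
  obtain ⟨hN₀, hss₀, h3₀⟩ := krizLiBinders_of_isIsogenous hmodP hiso hCM ψ ω hss h3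
  have hD0 : (NumberField.discr K : ℚ) ≠ 0 := by exact_mod_cast NumberField.discr_ne_zero K
  haveI : (W.quadraticTwist (NumberField.discr K : ℚ)).IsElliptic := W.isElliptic_quadraticTwist hD0
  haveI : (W₀.quadraticTwist (NumberField.discr K : ℚ)).IsElliptic := W₀.isElliptic_quadraticTwist hD0
  have hLt₀ : (W₀.quadraticTwist (NumberField.discr K : ℚ)).entireLFunction 1 ≠ 0 := by
    rw [← entireLFunction_eq_of_isIsogenous LFunction_eq_of_isIsogenous_holds (hiso.quadraticTwist hD0)]; exact hLt
  -- a Heegner point of `W₀` over the same field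
  subst hN
  haveI hN0 : NeZero (W₀.conductorNorm ℤ) := ⟨W₀.conductorNorm_pos_holds.ne'⟩
  have hHN₀ : SatisfiesHeegnerHypothesis (W₀.conductorNorm ℤ) K := by rw [hN₀]; exact hHN
  obtain ⟨P₀, Dt₀, H₀, ι₀, hP₀⟩ := hHP W₀ K hK hHN₀
  exact ⟨W₀.conductorNorm ℤ, hN0, K, _, _, Dt₀, H₀, ι₀, P₀, f, inferInstance, ψ, ω, εK, rfl, hK, hHN₀, hodd, hd4, hLt₀, hP₀, hψ, hω, hss₀,
    h1, h1', h3₀, hεK, h4⟩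

/-- **`BSD_p(W)` at a Kriz–Li datum of `W` over `K''` from the UPPER half at ONE Heegner datum over `K''` of ONE isogenous model `W₀`.**
The binders move to `W₀` (`krizLiBinders_of_isIsogenous`), so §2 of `…KrizLiLocusKolyvagin` gives `BSD_p(W₀)` (LOWER from print, UPPER the hypothesis),
and Cassels' invariance (`X2.bsdp_of_isIsogenous_of_bsdp`) gives `BSD_p(W)`. CONDITIONAL on the seven citations, Kriz–Li Thm. 1.20 and the one UPPER half.
[cite: KrizLi2019, Thm. 1.20 (pp. 7–8)] [cite: MilneADT2006, Thm. I.7.3] [cite: JetchevSkinnerWan2017, §7.4.1 (arXiv:1512.06894 p. 30)] -/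
theorem bsdp_cmRamified_of_krizLiDatum_of_isIsogenous_indexUpper
    (hprints : Hsieh2014.thmA_exists_isHsiehLFunction_unrPeriod_anyLevel ∧
      LiuZhangZhang2018.thm151_thm153_modularCurve_heegnerVector_additive ∧
      ToricPublishedInputs ∧
      (∀ (K : Type) [Field K] [NumberField K], poitouTate_sha_tateDual K) ∧
      bsdTriple_of_hasCM_of_L_one_ne_zero ∧ hasEntireLFunction_rat ∧ bsdRHS_eq_of_isIsogenous)
    (hKL : KrizLi2019.thm120_padicLogHeegner_unit_of_bernoulli)
    (W : WeierstrassCurve ℚ) [W.IsElliptic] [W.IsGloballyMinimal] (hCM : W.HasCM) (hram : CMRamified W p) (h5 : 5 ≤ p)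
    (hr : W.analyticRank = 1)
    (N : ℕ) [NeZero N] (K : Type) [Field K] [NumberField K]
    (hN : W.conductorNorm ℤ = N) (hK : IsImaginaryQuadratic K) (hHN : SatisfiesHeegnerHypothesis N K)
    (hodd : Odd (NumberField.discr K)) (hd4 : NumberField.discr K < -4)
    (hLt : (W.quadraticTwist (NumberField.discr K : ℚ)).entireLFunction 1 ≠ 0)
    (f : ℕ) [NeZero f] (ψ : DirichletCharacter ℚ_[p] f) (ω : DirichletCharacter ℚ_[p] p)
    (hψ : ψ.IsPrimitive) (hω : KrizLi2019.IsTeichmullerCharacter ω)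
    (hss : ∀ ℓ : ℕ, ℓ.Prime → ¬ (ℓ ∣ p * W.conductorNorm ℤ) →
      ‖((W.LFunction ℓ : ℤ) : ℚ_[p]) - (ψ (ℓ : ZMod f) + ψ⁻¹ (ℓ : ZMod f) * ω (ℓ : ZMod p))‖ < 1)
    (h1 : ψ (p : ZMod f) ≠ 1) (h1' : KrizLi2019.primVal (KrizLi2019.invMulOmega ψ ω) p ≠ 1)
    (h3 : ∀ ℓ : ℕ, (hℓ : ℓ.Prime) → ℓ ≠ p →
      (haveI := Fact.mk hℓ; ¬ W.HasGoodReductionAtPrime ℓ ∧ ¬ W.HasMultiplicativeReductionAtPrime ℓ) →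
      ψ (ℓ : ZMod f) ≠ 1 ∧ KrizLi2019.primVal (KrizLi2019.invMulOmega ψ ω) ℓ ≠ 1)
    (εK : DirichletCharacter ℚ_[p] (NumberField.discr K).natAbs) (hεK : KrizLi2019.IsKroneckerCharacterOf K εK)
    (h4 : ¬ (‖KrizLi2019.bernoulliOnePrim (KrizLi2019.bernoulliCharOne ψ εK) *
        KrizLi2019.bernoulliOnePrim (KrizLi2019.bernoulliCharTwo ψ εK ω)‖ ≤ (p : ℝ)⁻¹))
    -- ONE isogenous model and ONE Heegner datum of it over the same field, with the UPPER half there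
    (W₀ : WeierstrassCurve ℚ) [W₀.IsElliptic] [W₀.IsGloballyMinimal] (hiso : IsIsogenous W W₀)
    (Dt₀ : ModularParametrizationData W₀ N) (H₀ : HeegnerDatum N (NumberField.discr K)) (ι₀ : K →+* ℂ)
    (P₀ : (W₀.baseChange K).toAffine.Point)
    (hP₀ : WeierstrassCurve.Affine.Point.map ι₀.toRatAlgHom P₀ = heegnerPointComplex Dt₀ H₀)
    (hup₀ : ¬ IsOfFinAddOrder P₀ →
      padicValNat p (W₀.baseChange K).shaOrder + 2 * padicValNat p Dt₀.c.natAbs ≤ 2 * padicValNat p (AddSubgroup.zmultiples P₀).index) :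
    BSDp W p := by
  obtain ⟨-, -, hF, -, -, hmod, hCassels⟩ := id hprints
  obtain ⟨-, -, hGZK, -, hmodP, -, -, -, -, -⟩ := id hF
  have hCM₀ : W₀.HasCM := X12.hasCM_of_isIsogenous hiso hCM
  have hram₀ : CMRamified W₀ p := (X12.cmRamified_iff_of_isIsogenous hiso hCM p).mp hram
  have hr₀ : W₀.analyticRank = 1 := by rw [← analyticRank_eq_of_isIsogenous LFunction_eq_of_isIsogenous_holds hiso]; exact hr
  obtain ⟨hN₀, hss₀, h3₀⟩ := krizLiBinders_of_isIsogenous hmodP hiso hCM ψ ω hss h3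
  have hD0 : (NumberField.discr K : ℚ) ≠ 0 := by exact_mod_cast NumberField.discr_ne_zero K
  haveI : (W.quadraticTwist (NumberField.discr K : ℚ)).IsElliptic := W.isElliptic_quadraticTwist hD0
  haveI : (W₀.quadraticTwist (NumberField.discr K : ℚ)).IsElliptic := W₀.isElliptic_quadraticTwist hD0
  have hLt₀ : (W₀.quadraticTwist (NumberField.discr K : ℚ)).entireLFunction 1 ≠ 0 := by
    rw [← entireLFunction_eq_of_isIsogenous LFunction_eq_of_isIsogenous_holds (hiso.quadraticTwist hD0)]; exact hLt
  have hB₀ : BSDp W₀ p :=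
    bsdp_cmRamified_of_krizLiDatum_of_indexUpper hprints hKL W₀ hCM₀ hram₀ h5 hr₀ N K Dt₀ H₀ ι₀ P₀ (hN₀.trans hN) hK hHN hodd hd4 hLt₀
      hP₀ f ψ ω hψ hω hss₀ h1 h1' h3₀ εK hεK h4 (fun hnt ↦ indexUpperBoundLeAt_of_sha_le_index_of_hasCM hCM₀ h5 (hup₀ hnt))
  exact X2.bsdp_of_isIsogenous_of_bsdp hCassels hGZK hmod W₀ W hiso.symm_of_charZero p hr₀.le hB₀

/-- **The UPPER half everywhere from `BSD_p(W)`** (class form of `indexUpperBoundLeAt_of_bsdp_of_bsdp`): for a class member with `BSD_p(W)`, the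
UPPER index half holds at EVERY admissible Heegner datum of `W` (`d` odd `< −4`, `L(W^{(d)},1) ≠ 0`) — the partner `BSD_p` is Burungale–Flach. So
on an isogeny class the Kolyvagin inequality at ONE datum of ONE model (plus the LOWER half there) gives it at all data of all models.
[cite: GrossZagier1986, I.(6.3) and Thm. I.7.3] [cite: BurungaleFlach2024, Thm. 1.1 and Cor. 2] -/
theorem indexUpperBoundLeAt_cmRamified_of_bsdp
    (hprints : Hsieh2014.thmA_exists_isHsiehLFunction_unrPeriod_anyLevel ∧
      LiuZhangZhang2018.thm151_thm153_modularCurve_heegnerVector_additive ∧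
      ToricPublishedInputs ∧
      (∀ (K : Type) [Field K] [NumberField K], poitouTate_sha_tateDual K) ∧
      bsdTriple_of_hasCM_of_L_one_ne_zero ∧ hasEntireLFunction_rat ∧ bsdRHS_eq_of_isIsogenous)
    (W : WeierstrassCurve ℚ) [W.IsElliptic] [W.IsGloballyMinimal] (hCM : W.HasCM) (hram : CMRamified W p) (h5 : 5 ≤ p)
    (hr : W.analyticRank = 1) (hB : BSDp W p)
    (N : ℕ) [NeZero N] (K : Type) [Field K] [NumberField K]
    (Dt : ModularParametrizationData W N) (H : HeegnerDatum N (NumberField.discr K)) (ι : K →+* ℂ)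
    (P : (W.baseChange K).toAffine.Point)
    (hN : W.conductorNorm ℤ = N) (hK : IsImaginaryQuadratic K) (hHN : SatisfiesHeegnerHypothesis N K)
    (hodd : Odd (NumberField.discr K)) (hd4 : NumberField.discr K < -4)
    (hLt : (W.quadraticTwist (NumberField.discr K : ℚ)).entireLFunction 1 ≠ 0)
    (hP : WeierstrassCurve.Affine.Point.map ι.toRatAlgHom P = heegnerPointComplex Dt H) :
    Upper.IndexUpperBoundLeAt W p K P (padicValNat p Dt.c.natAbs) := by
  have hp : p.Prime := Fact.out
  have hp2 : p ≠ 2 := by omega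
  obtain ⟨-, -, hF, -, hBF, hmod, -⟩ := id hprints
  obtain ⟨hGZ, hKo, hGZK, -, -, -, hGZ73, -, -, -⟩ := id hF
  have hadd : Addv W p := addv_of_cmRamified W hCM hram h5
  have hpN : p ∣ N := by rw [← hN]; exact (W.dvd_conductorNorm_iff_not_hasGoodReductionAtPrime p).mpr hadd.1
  have hw : ¬ p ∣ Units.torsionOrder K := by
    rw [Literature.NumberTheory.QuadraticFields.Quadratic.torsionOrder_eq_two_of_discr_lt_neg_four hK.1 hd4]
    intro h
    exact hp2 ((Nat.prime_dvd_prime_iff_eq hp Nat.prime_two).mp h)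
  have hD0 : (NumberField.discr K : ℚ) ≠ 0 := by exact_mod_cast NumberField.discr_ne_zero K
  haveI : (W.quadraticTwist (NumberField.discr K : ℚ)).IsElliptic := W.isElliptic_quadraticTwist hD0
  obtain ⟨Cd, hCd⟩ := hasGlobalMinimalModel_rat_holds (W.quadraticTwist (NumberField.discr K : ℚ))
  haveI : (Cd • W.quadraticTwist (NumberField.discr K : ℚ)).IsGloballyMinimal := hCd
  have hWd : BSDp (Cd • W.quadraticTwist (NumberField.discr K : ℚ)) p :=
    rankZeroTwistBSDp_of_hasCM hBF hmod W hCM N K (Cd • W.quadraticTwist (NumberField.discr K : ℚ)) hN hK hHN ⟨Cd, rfl⟩ hLt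
  exact WildKolyvaginUpperAtThreeOfJointUpper.indexUpperBoundLeAt_of_bsdp_of_bsdp hGZ hKo hGZK hmod hGZ73 W p N K Dt H ι P
    (Cd • W.quadraticTwist (NumberField.discr K : ℚ)) hr hN hpN hK hodd hw hHN hLt hP ⟨Cd, rfl⟩ hp2 hB hWd

/-- **Off the locus: `BSD_p(W)` from β1 for ONE isogenous model `W₀` and the UPPER half at ONE Heegner datum of `W₀`** (admissible field: `d` odd
`< −4`, Heegner for `N_W`, `L(W^{(d)},1) ≠ 0`). LOWER at that datum from β1 pointwise (`indexLowerBoundLeAt_of_flatInclLe_of_control`, torsion from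
control at `𝔭′`), partner by Burungale–Flach, `Exact.bsdp_of_exactIndexManin_of_partner_bsdp` for `W₀`, Cassels to `W`. CONDITIONAL.
[cite: JetchevSkinnerWan2017, §7.4.1 (arXiv:1512.06894 p. 30)] [cite: MilneADT2006, Thm. I.7.3] [cite: Hsieh2014, Thm. A p. 712 (Doc. Math. 19)] -/
theorem bsdp_cmRamified_of_flatIncl_of_isIsogenous_indexUpper
    (hprints : Hsieh2014.thmA_exists_isHsiehLFunction_unrPeriod_anyLevel ∧
      LiuZhangZhang2018.thm151_thm153_modularCurve_heegnerVector_additive ∧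
      ToricPublishedInputs ∧
      (∀ (K : Type) [Field K] [NumberField K], poitouTate_sha_tateDual K) ∧
      bsdTriple_of_hasCM_of_L_one_ne_zero ∧ hasEntireLFunction_rat ∧ bsdRHS_eq_of_isIsogenous)
    (W : WeierstrassCurve ℚ) [W.IsElliptic] [W.IsGloballyMinimal] (hCM : W.HasCM) (hram : CMRamified W p) (h5 : 5 ≤ p)
    (hr : W.analyticRank = 1)
    (N : ℕ) [NeZero N] (K : Type) [Field K] [NumberField K]
    (hN : W.conductorNorm ℤ = N) (hK : IsImaginaryQuadratic K) (hHN : SatisfiesHeegnerHypothesis N K)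
    (hodd : Odd (NumberField.discr K)) (hd4 : NumberField.discr K < -4)
    (hLt : (W.quadraticTwist (NumberField.discr K : ℚ)).entireLFunction 1 ≠ 0)
    (W₀ : WeierstrassCurve ℚ) [W₀.IsElliptic] [W₀.IsGloballyMinimal] (hiso : IsIsogenous W W₀)
    (Dt₀ : ModularParametrizationData W₀ N) (H₀ : HeegnerDatum N (NumberField.discr K)) (ι₀ : K →+* ℂ)
    (P₀ : (W₀.baseChange K).toAffine.Point)
    (hP₀ : WeierstrassCurve.Affine.Point.map ι₀.toRatAlgHom P₀ = heegnerPointComplex Dt₀ H₀)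
    -- β1 for `W₀` at this `(N, K, Dt₀)`, every frame (v3 form)
    (hIncl₀ : ∀ (κ : ZpExtension K p), κ.IsAnticyclotomic → ∀ (γ : Field.absoluteGaloisGroup K) [Fact (κ.IsTopGenerator γ)]
        (𝔭 : HeightOneSpectrum (𝓞 K)), ((p : ℕ) : 𝓞 K) ∈ 𝔭.asIdeal → 𝔭.asIdeal.ramificationIdx (𝓞 ℚ) = 1 →
        𝔭.asIdeal.inertiaDeg (𝓞 ℚ) = 1 → ∀ (𝔭' : HeightOneSpectrum (𝓞 K)), ((p : ℕ) : 𝓞 K) ∈ 𝔭'.asIdeal → 𝔭' ≠ 𝔭 →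
        ∀ (ι' : PadicAlgCl p ≃+* ℂ), SchneiderFree.BranchInducesPrime p ι' 𝔭 →
        ∀ (ΩK : ℂ) (Ωp : ℂ_[p]) (Q : PowerSeries (PadicComplexInt p)), ΩK ≠ 0 → Ωp ≠ 0 →
          R1.IsBDPLFunctionInt p ι' 𝔭 κ γ Dt₀.f ΩK Ωp Q →
          Module.IsTorsion (IwasawaAlgebra p) (XAc (W₀.baseChange K) p κ 𝔭' ∅ γ) →
          (XAc.charIdeal (W₀.baseChange K) p κ 𝔭' ∅ γ).map (PowerSeries.map (R1.toCpInt p)) ≤ Ideal.span {Q})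
    (hup₀ : ¬ IsOfFinAddOrder P₀ →
      padicValNat p (W₀.baseChange K).shaOrder + 2 * padicValNat p Dt₀.c.natAbs ≤ 2 * padicValNat p (AddSubgroup.zmultiples P₀).index) :
    BSDp W p := by
  have hp : p.Prime := Fact.out
  have hp2 : p ≠ 2 := by omega
  obtain ⟨hA, hL, hF, hPT2, hBF, hmod, hCassels⟩ := id hprints
  obtain ⟨hGZ, hKo, hGZK, -, hmodP, -, hGZ73, -, -, -⟩ := id hF
  obtain ⟨hPT, hEP, hcd, hBr⟩ := EisensteinResourceBdpLine.prints_four_hold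
  have hCM₀ : W₀.HasCM := X12.hasCM_of_isIsogenous hiso hCM
  have hram₀ : CMRamified W₀ p := (X12.cmRamified_iff_of_isIsogenous hiso hCM p).mp hram
  have hr₀ : W₀.analyticRank = 1 := by rw [← analyticRank_eq_of_isIsogenous LFunction_eq_of_isIsogenous_holds hiso]; exact hr
  have hN₀ : W₀.conductorNorm ℤ = N := (conductorNorm_eq_of_isIsogenous_of_modularity hmodP W W₀ hiso).symm.trans hN
  have hD0 : (NumberField.discr K : ℚ) ≠ 0 := by exact_mod_cast NumberField.discr_ne_zero K
  haveI : (W.quadraticTwist (NumberField.discr K : ℚ)).IsElliptic := W.isElliptic_quadraticTwist hD0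
  haveI : (W₀.quadraticTwist (NumberField.discr K : ℚ)).IsElliptic := W₀.isElliptic_quadraticTwist hD0
  have hLt₀ : (W₀.quadraticTwist (NumberField.discr K : ℚ)).entireLFunction 1 ≠ 0 := by
    rw [← entireLFunction_eq_of_isIsogenous LFunction_eq_of_isIsogenous_holds (hiso.quadraticTwist hD0)]; exact hLt
  have hadd₀ : Addv W₀ p := addv_of_cmRamified W₀ hCM₀ hram₀ h5
  have hpN : p ∣ N := by rw [← hN₀]; exact (W₀.dvd_conductorNorm_iff_not_hasGoodReductionAtPrime p).mpr hadd₀.1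
  -- the Heegner point of `W₀` is non-torsion (Gross–Zagier at `r_an(W₀/K) = 1`)
  have hL0 : W₀.entireLFunction 1 = 0 := entireLFunction_one_eq_zero_of_analyticRank_eq_one hr₀
  obtain ⟨-, hderiv⟩ := leadingLCoeff_eq_deriv_of_analyticRank_eq_one hr₀
  have hLK : LDerivEK W₀ K ≠ 0 := by
    rw [lDerivEK_eq_deriv_mul W₀ K hmod hL0]; exact mul_ne_zero hderiv hLt₀
  have hnt₀ : ¬ IsOfFinAddOrder P₀ :=
    (lDerivEK_ne_zero_iff_not_isOfFinAddOrder W₀ N K (hGZ _ W₀ K) hK hHN ⟨Dt₀, H₀, ι₀, hP₀⟩).mp hLK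
  -- exact control of the class for `W₀`
  have hCtl₀ := additiveControl_heegner_of_cmRamified (p := p) hPT hPT2 hEP hcd hBr W₀ hCM₀ hram₀ h5
  -- LOWER half at the datum from β1 (torsion at `𝔭′` from control at `𝔭′`)
  have hlo : IndexLowerBoundLeAt W₀ p K P₀ (padicValNat p Dt₀.c.natAbs) :=
    indexLowerBoundLeAt_of_flatInclLe_of_control hp2 hA hL Dt₀ H₀ ι₀ P₀ hadd₀ hN₀ hK hHN hd4 hP₀ hnt₀ (hKo N W₀ K)
      (fun κ hκ γ _ 𝔭 h𝔭 he hf 𝔭' h𝔭' hne ι' hind ΩK Ωp Q hΩK hΩp hBDP ↦ by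
        obtain ⟨he', hf'⟩ := degreeOne_of_dvd_of_heegner hK hHN hpN h𝔭'
        obtain ⟨n, hn, -⟩ := hCtl₀ N K Dt₀ H₀ ι₀ P₀ hN₀ hK hHN hLt₀ hP₀ hnt₀ (hKo N W₀ K) κ hκ γ 𝔭' h𝔭' he' hf'
        exact hIncl₀ κ hκ γ 𝔭 h𝔭 he hf 𝔭' h𝔭' hne ι' hind ΩK Ωp Q hΩK hΩp hBDP hn.1)
      (fun κ hκ γ _ 𝔭 h𝔭 he hf ↦ hCtl₀ N K Dt₀ H₀ ι₀ P₀ hN₀ hK hHN hLt₀ hP₀ hnt₀ (hKo N W₀ K) κ hκ γ 𝔭 h𝔭 he hf)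
  have hupI : Upper.IndexUpperBoundLeAt W₀ p K P₀ (padicValNat p Dt₀.c.natAbs) :=
    indexUpperBoundLeAt_of_sha_le_index_of_hasCM hCM₀ h5 (hup₀ hnt₀)
  have hw : ¬ p ∣ Units.torsionOrder K := by
    rw [Literature.NumberTheory.QuadraticFields.Quadratic.torsionOrder_eq_two_of_discr_lt_neg_four hK.1 hd4]
    intro h
    exact hp2 ((Nat.prime_dvd_prime_iff_eq hp Nat.prime_two).mp h)
  obtain ⟨Cd, hCd⟩ := hasGlobalMinimalModel_rat_holds (W₀.quadraticTwist (NumberField.discr K : ℚ))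
  haveI : (Cd • W₀.quadraticTwist (NumberField.discr K : ℚ)).IsGloballyMinimal := hCd
  have hWd : BSDp (Cd • W₀.quadraticTwist (NumberField.discr K : ℚ)) p :=
    rankZeroTwistBSDp_of_hasCM hBF hmod W₀ hCM₀ N K (Cd • W₀.quadraticTwist (NumberField.discr K : ℚ)) hN₀ hK hHN ⟨Cd, rfl⟩ hLt₀
  have hB₀ : BSDp W₀ p :=
    SchneiderFree.Exact.bsdp_of_exactIndexManin_of_partner_bsdp hGZ hKo hGZK hmod hGZ73 W₀ p N K Dt₀ H₀ ι₀ P₀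
      (Cd • W₀.quadraticTwist (NumberField.discr K : ℚ)) hr₀ hN₀ hpN hK hodd hw hHN hLt₀ hP₀ ⟨Cd, rfl⟩ hp2 hlo hupI hWd
  exact X2.bsdp_of_isIsogenous_of_bsdp hCassels hGZK hmod W₀ W hiso.symm_of_charZero p hr₀.le hB₀

end Transport

end Summit.BirchSwinnertonDyer.BirchSwinnertonDyer.Theorems.PrintCFram.KrizLiKolyvagin

end
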